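import Mathlib
import Summits.Ventures.PercRepro.TriangleCapThreeTrianglesG

/-!
# PercRepro — THE CELL `(8, 13)`, PART A: THREE TRIANGLES WITH ONE SHARED VERTEX FILL THE GRAPH (p3, gen 37; part 73)

On `8` vertices, three triangles with exactly one shared vertex `t` (`T₁ ∩ T₂ = {t}`, `T₃` disjoint) have
`S = T₁ ∪ T₂ ∪ T₃ = V`, so `Q = 2m = 26`, and the far count of TriangleCapThreeTrianglesA reads
`Σ deficit ≥ 162 − 4 (Q + degIn S t) ≥ 162 − 4 · 31 = 38 = 4k + 6` (`degIn S t ≤ 5`) — tight, as the census says.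

* **`three_triangles_one_shared_eight_thirteen`** — the `r = 2` bound for this configuration at `(8, 13)`.
Axioms: standard.
-/

namespace PercRepro

namespace TriangleCap

namespace C047

open Finset

variable {V : Type*} [Fintype V] [DecidableEq V]

/-- **THREE TRIANGLES WITH ONE SHARED VERTEX AT `(8, 13)`.** -/
theorem three_triangles_one_shared_eight_thirteen (D : SimpleGraph V) [DecidableRel D.Adj] (hK : K4mFree D)
    (hk : Fintype.card V = 8) (hm : D.edgeFinset.card = 13) (T₁ T₂ T₃ : Finset V)
    (h₁ : T₁.card = 3) (h₂ : T₂.card = 3) (h₃ : T₃.card = 3) {t : V}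
    (hint : T₁ ∩ T₂ = {t}) (h13 : Disjoint T₁ T₃) (h23 : Disjoint T₂ T₃)
    (hcl₁ : ∀ x ∈ T₁, ∀ y ∈ T₁, x ≠ y → D.Adj x y) (hcl₂ : ∀ x ∈ T₂, ∀ y ∈ T₂, x ≠ y → D.Adj x y)
    (hcl₃ : ∀ x ∈ T₃, ∀ y ∈ T₃, x ≠ y → D.Adj x y)
    (hone₃ : ∀ z, z ∉ T₃ → degIn D T₃ z ≤ 1)
    (hT : ∀ x y z, D.Adj x y → D.Adj x z → D.Adj y z →
      (x ∈ T₁ ∧ y ∈ T₁) ∨ (x ∈ T₂ ∧ y ∈ T₂) ∨ (x ∈ T₃ ∧ y ∈ T₃)) :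
    ∑ v, deg D v * deg D v + 2 * (Fintype.card V - 3) ≤ D.edgeFinset.card * Fintype.card V := by
  have hi12 : (T₁ ∩ T₂).card ≤ 1 := by rw [hint, card_singleton]
  have hi13 : (T₁ ∩ T₃).card ≤ 1 := by rw [disjoint_iff_inter_eq_empty.mp h13, card_empty]; exact Nat.zero_le _
  have hi23 : (T₂ ∩ T₃).card ≤ 1 := by rw [disjoint_iff_inter_eq_empty.mp h23, card_empty]; exact Nat.zero_le _
  have hcount := three_triangles_far_count D T₁ T₂ T₃ h₁ h₂ h₃ hi12 hi13 hi23 hcl₁ hcl₂ hcl₃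
  have ht1 : t ∈ T₁ := (mem_inter.mp (by rw [hint]; exact mem_singleton_self t)).1
  set S := T₁ ∪ T₂ ∪ T₃ with hS
  have hd12 : Disjoint (T₁ ∪ T₂) T₃ := disjoint_union_left.mpr ⟨h13, h23⟩
  have h12card : (T₁ ∪ T₂).card = 5 := by
    have := card_union_add_card_inter T₁ T₂
    rw [hint, card_singleton, h₁, h₂] at this
    omega
  have hScard : S.card = 8 := by rw [hS, card_union_of_disjoint hd12, h12card, h₃]
  have hRempty : Sᶜ = ∅ := by rw [← card_eq_zero, card_compl, hScard, hk]
  -- `degIn S t ≤ 5`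
  have hcr_t : degIn D S t ≤ 5 := by
    have h1 : degIn D S t ≤ degIn D (T₁ ∪ T₂) t + degIn D T₃ t := by
      rw [hS]; exact degIn_union_le D (T₁ ∪ T₂) T₃ t
    have h2 : degIn D (T₁ ∪ T₂) t ≤ 4 := by
      have := degIn_le_card_sub_one D (mem_union_left T₂ ht1)
      rw [h12card] at this
      exact this
    have h3 := hone₃ t (fun h => disjoint_left.mp h13 ht1 h)
    omega
  -- the triangle sums are `Q + degIn S t`
  have hA : ∑ x ∈ T₁, degIn D S x + ∑ x ∈ T₂, degIn D S x + ∑ x ∈ T₃, degIn D S x = adjPairs D S + degIn D S t := by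
    have e : adjPairs D S = ∑ x ∈ T₁ ∪ T₂, degIn D S x + ∑ x ∈ T₃, degIn D S x := by
      rw [adjPairs_eq_sum_degIn, hS, sum_union hd12]
    have e2 := sum_union_inter (s₁ := T₁) (s₂ := T₂) (f := degIn D S)
    rw [hint, sum_singleton] at e2
    omega
  -- `Q = 2m`
  have hdens := two_mul_card_edges_eq_adjPairs_add D S
  simp only [hRempty, sum_empty, card_empty, mul_zero, zero_mul, add_zero, zero_add] at hdens hcount
  rw [hScard] at hcount
  have h18 := card_triangles3_le_eighteen_of_three D T₁ T₂ T₃ h₁ h₂ h₃ hcl₁ hcl₂ hcl₃ hT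
    (fun x y z z' hxy hxz hyz hxz' hyz' => eq_of_common_nbr D hK hxy hxz hyz hxz' hyz')
  have hid := two_mul_sum_deg_sq_add_sum_deficit D
  have hmk : 2 * (D.edgeFinset.card * Fintype.card V) = 2 * D.edgeFinset.card * Fintype.card V := by ring
  rw [hk, hm] at hid hmk ⊢
  rw [hm] at hdens
  omega

end C047

end TriangleCap

end PercRepro
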